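import Mathlib.AlgebraicGeometry.Morphisms.Proper
import Mathlib.AlgebraicGeometry.Morphisms.FiniteType
import Literature.AlgebraicGeometry.Motives.AlgPoints
import HarnessLib

/-!
# Verdier's generic topological local triviality of proper morphisms, with closed subsets (named fact)

Topic `Literature/AlgebraicGeometry/Motives`. NAMED FACT (D-0014) `Verdier1976_genericLocalTriviality`:
J.-L. Verdier, *Stratifications de Whitney et théorème de Bertini–Sard*, Invent. Math. 36 (1976):
Thm. (2.2) (every finite family of closed algebraic/analytic subsets admits an adapted Whitney
stratification), Thm. (3.3) (Bertini–Sard for stratified proper morphisms: over a dense Zariski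
open of the image the morphism is a stratified submersion), Thm. (4.14) (the first Thom–Mather
isotopy lemma: a proper stratified submersion is topologically locally trivial, compatibly with the
strata), Cor. (5.1) (hence: a proper morphism of complex algebraic varieties is, over a dense
Zariski open subset of any irreducible closed subvariety of the base, a topologically locally
trivial fibration in the strong topology, the trivialisations respecting a given finite family of
closed subvarieties of the source); Dimca 1992, Ch. 1, (3.5)–(3.6) for the same package. Stated on
the tree's carriers (`Motives.ComplexPoints`, `AlgPoints.map`, `AlgPoints.pt`, strong topology):
for `g : X ⟶ T'` proper with `T'` separated of finite type over `ℂ`, finitely many Zariski-closed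
`C i ⊆ X`, and `Y ⊆ T'` closed irreducible, there is an open `O ⊆ T'` meeting `Y` such that every
complex point `y₀` over `Y ∩ O` has a neighbourhood `V` in the complex points over `Y ∩ O` and a
homeomorphism `V × g⁻¹(y₀)(ℂ) ≃ₜ g⁻¹(V)(ℂ)` over `V` preserving membership in each `(C i)(ℂ)`.

This is VERBATIM the inline hypothesis `hGT` of
`Literature/AlgebraicGeometry/HodgeTheory/AlgebraicityLocusFromFacts`
(`pairTrivialisation_of_genericPairTriviality`,
`charlesSchnell_algebraicityLocus_iUnion_closed_of_mumford_of_genericPairTriviality`), whose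
docstrings announce it "to be recorded as the named fact `Motives.Verdier1976_genericLocalTriviality`",
and of `HodgeTheory/SpreadSupportsOverCurveProofs` (`spread_supports_over_smoothCurve_of_verdier`).
Recording it makes the single remaining published input of the structure theorem on algebraicity
loci (`charlesSchnell_algebraicityLocus_iUnion_closed`) and of the spreading fact
(`spread_supports_over_smoothCurve`) a tracked named fact. Nothing is proved here (the proof is
Whitney stratification theory: Thom–Mather isotopy, controlled vector fields — no carrier in
Mathlib).

## References

* [Verdier1976] J.-L. Verdier, Stratifications de Whitney et théorème de Bertini–Sard, Invent.
  Math. 36 (1976) 295–312, Thm. (2.2), Thm. (3.3), Thm. (4.14), Cor. (5.1).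
* [Dimca1992] A. Dimca, Singularities and Topology of Hypersurfaces (1992), Ch. 1, (3.5)–(3.6).
-/

noncomputable section

open CategoryTheory AlgebraicGeometry Topology Filter

namespace Literature.AlgebraicGeometry.Motives

/-- **Verdier's generic topological local triviality of proper morphisms, compatibly with finitely
many closed subsets** (named fact). For a proper morphism `g : X ⟶ T'` of `ℂ`-schemes with `T'`
separated and of finite type over `ℂ` (locally of finite type with quasi-compact underlying space),
finitely many Zariski-closed `C i ⊆ X`, and an irreducible closed `Y ⊆ T'`, there is an open
`O ⊆ T'` meeting `Y` such that for every complex point `y₀` over `Y ∩ O` there are a neighbourhood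
`V` of `y₀` in the complex points over `Y ∩ O` and a homeomorphism
`φ : V × {x ∈ X(ℂ) | g x = y₀} ≃ₜ {x ∈ X(ℂ) | g x ∈ V}` over `V` (`g (φ (v, x)) = v`) which preserves
membership in each `(C i)(ℂ)` (`pt (φ (v, x)) ∈ C i ↔ pt x ∈ C i`). Printed: Verdier 1976,
Cor. (5.1) with Thm. (2.2) (Whitney stratifications adapted to a finite family of closed subsets),
Thm. (3.3) (Bertini–Sard for stratified proper morphisms, over a dense Zariski open of the image —
here of the irreducible `Y`, i.e. over `Y ∩ O`) and Thm. (4.14) (first isotopy lemma); Dimca 1992,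
Ch. 1, (3.5)–(3.6). The strong topology only sees the reduced analytic spaces `X(ℂ) → T'(ℂ)`, a
proper holomorphic map, to which the printed statements apply.
[cite: Verdier1976, Thm. (2.2), Thm. (3.3), Thm. (4.14), Cor. (5.1)]
[cite: Dimca1992, Ch. 1, (3.5)–(3.6)] -/
def Verdier1976_genericLocalTriviality : Prop :=
  ∀ ⦃X T' : SchemeOver ℂ⦄ (g : X ⟶ T'), IsSeparated T'.hom →
    LocallyOfFiniteType T'.hom → CompactSpace T'.left → IsProper g.left →
    ∀ ⦃ι : Type⦄ [Finite ι] (C : ι → Set X.left), (∀ i, IsClosed (C i)) →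
    ∀ ⦃Y : Set T'.left⦄, IsClosed Y → IsIrreducible Y →
      ∃ O : T'.left.Opens, (Y ∩ (O : Set T'.left)).Nonempty ∧
        ∀ y₀ : ComplexPoints T', y₀.pt ∈ Y ∧ y₀.pt ∈ (O : Set T'.left) →
          ∃ V : Set (ComplexPoints T'),
            V ⊆ {y | y.pt ∈ Y ∧ y.pt ∈ (O : Set T'.left)} ∧
            V ∈ 𝓝[{y | y.pt ∈ Y ∧ y.pt ∈ (O : Set T'.left)}] y₀ ∧
            ∃ φ : ↥V × {x : ComplexPoints X // AlgPoints.map g x = y₀} ≃ₜ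
                {x : ComplexPoints X // AlgPoints.map g x ∈ V},
              (∀ p, AlgPoints.map g ((φ p : {x : ComplexPoints X // AlgPoints.map g x ∈ V}) :
                  ComplexPoints X) = (p.1 : ComplexPoints T')) ∧
              (∀ p i, ((φ p : {x : ComplexPoints X // AlgPoints.map g x ∈ V}) :
                  ComplexPoints X).pt ∈ C i ↔
                ((p.2 : {x : ComplexPoints X // AlgPoints.map g x = y₀}) : ComplexPoints X).pt ∈ C i)

end Literature.AlgebraicGeometry.Motives

end
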